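import Literature.NumberTheory.LFunctions.Zhang2022.KnifeEdgeLenZDegreeShortPolyBinom
import Literature.NumberTheory.LFunctions.Zhang2022.Section15GammaFactorSteps
import Literature.NumberTheory.LFunctions.Zhang2022.ClosedFormsPartOne
import Literature.NumberTheory.LFunctions.Zhang2022.KnifeEdgeEndgameClosed
import Literature.NumberTheory.LFunctions.Zhang2022.Section11Deductions

/-!
# Zhang (2022), rung F-S3 (Landau–Siegel programme, §D CHAIN #1 toeplitz closure squad): the degree-2 ψ-graded cross
# cell LOWERED at the sampled zeros — `Z(ρ,ψ)⁻² = −(χ(p)/τ(χ))·ψ(D)D^{1−ρ}G(ρ,ψ)·F(1−ρ,ψ̄) + O(𝓛⁻¹⁰⁰)` from the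
# manuscript's (M4) unit and Lemma 4.8, both TREE THEOREMS (PROVED; nothing asserted)

Y. Zhang, *Discrete mean estimates and the Landau–Siegel zero*, arXiv:2211.02515v1 [Zhang2022LandauSiegel] — an
unrefereed manuscript under adjudication. **WHAT THIS IS NOT: not a claim about Theorems 1–2 of arXiv:2211.02515, about
Landau–Siegel zeros, or about Parity. The programme SEARCHES and TYPES; no claim about Landau–Siegel zeros, Theorems 1–2 of
arXiv:2211.02515 or a repaired Margin232 until a kernel theorem says so.** Every `def` below has a body; every `theorem`
is algebra on top of TREE THEOREMS: the exact (2.4) `GammaFactor.Zfac_eq`, the Gauss-sum factorisation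
`τ(χψ) = τ(χ)τ(ψ)ψ(D)χ(p)` (`Typed.Section15A.step15_u005_holds`), Lemma 4.8 (`Skeleton.lemma48_holds`), Prop. 2.2 (i)
(`Skeleton.prop22i_holds`) and the weight positivity `Re 𝔠*·Re ω ≥ 0` (`KnifeEdge.weights_nonneg_eventually`). No open `Prop`.

## What this file does (ls-knife-toeplitz-typer-1 g2, cell `landau-siegel` §D, 2026-08-27; DISPLAY #1 (2)–(5) and
## DISPLAY #3 = K1A-DISPLAY-3-Daudit.md §1 (1a) of the K1″a hand, made kernel statements)

The open input of the port stmt-Parity-20429 (`ShortPairsTauTwoDark`) is the darkness of the degree-2 cross cell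
`τ₂ = Σ_{(ψ,ρ)} Re 𝔠*·Z(ρ,ψ)²·conj Q_g(ρ)·conj H_f(ρ)·Re ω` (`KnifeEdge.crossCell c′ χ 2 g f`) on binomial short pairs
(`KnifeEdgeLenZDegreeShortPolyBinom`). The manuscript-type derivation (DISPLAY #1/#3) LOWERS the cell once, at each zero:

* Part 1 — **(M4) ON THE CRITICAL LINE.** The unit `𝔲(s,ψ) := τ(χ)χ(p)ψ̄(D)D^{s−1}` (`m4Unit`) and, for `ψ ∈ Ψ`, `D ≥ 3`
  and `Im s ≥ 1`: `‖Z(s,ψ)/Z(s,χψ) − 𝔲(s,ψ)‖ ≤ 15e^{−π Im s}‖𝔲(s,ψ)‖` (`norm_zfac_div_zpc_sub_m4Unit_le`) — the proof of the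
  tree's `Typed.Section15A.step15_u006_holds` (§15 p. 80, where `s` runs on the segment `𝔍(−α)`) with its segment
  hypothesis replaced by the only thing it uses, `Im s ≥ 1`; and the exact inverse
  `𝔲(s,ψ)·(χ(−1)τ(χ)ψ(D)χ(p)D^{−s}) = 1` (`m4Unit_mul_inv_eq_one`), i.e. `𝔲⁻¹ = (χ(p)/τ(χ))·ψ(D)D^{1−s}`
  (`m4Unit_inv_eq`).
* Part 2 — **LEMMA 4.8 ON THE SAMPLED ZEROS.** Every index `(ψ,ρ) ∈ idx χ` has `ψ ∈ Ψ₁` and `ρ ∈ 𝔷(ψ) ⊆ {zeros of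
  L(s,ψ)L(s,ψχ) in Ω}`, so Lemma 4.8 applies: `‖Z̃(ρ,ψ)⁻¹ + G(ρ,ψ)F(1−ρ,ψ̄)‖ ≤ C𝓛⁻¹⁰⁰` (`lemma48_on_idx`); and
  `Im ρ ≥ 5𝓛⁵¹⁹ ≥ 1`, `e^{−π Im ρ} ≤ 𝓛⁻¹⁰⁰` there (`five_pow_le_im_of_mem_zeroSet`, `exp_neg_pi_im_le_of_mem_zeroSet`).
* Part 3 — **THE POINTWISE LOWERING** at `(ψ,ρ) ∈ idx χ` under Prop. 2.2 (i) (`Re ρ = ½`, so `|Z(ρ,ψ)| = |Z(ρ,ψχ)| = 1`):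
  `Z(ρ,ψ)⁻² = Z̃(ρ,ψ)⁻¹·(Z(ρ,ψ)/Z(ρ,ψχ))⁻¹`, hence
  `‖Z(ρ,ψ)⁻² + 𝔲(ρ,ψ)⁻¹·G(ρ,ψ)·F(1−ρ,ψ̄)‖ ≤ C𝓛⁻¹⁰⁰ + 15e^{−π Im ρ} ≤ (C+15)𝓛⁻¹⁰⁰` (`zfac_inv_sq_lowering_on_idx`).
* Part 4 — **THE SUMMED FORM** (DISPLAY #3 §1 (1a) «conj τ₂ = −τ(χ)⁻¹·𝔖 + R₁»): with
  `𝔖 := Σ_{(ψ,ρ)∈idx} χ(p)·Re 𝔠*·[ψ(D)D^{1−ρ}G(ρ,ψ)Q_g(ρ)H_f(ρ)]·F(1−ρ,ψ̄)·Re ω` (`tauTwoLoweredSum`),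
  `conj τ₂ = Σ Re 𝔠*·Z(ρ,ψ)⁻²·Q_gH_f·Re ω` (`conj_crossCell_two_eq`) and
  `‖conj τ₂ + τ(χ)⁻¹·𝔖‖ ≤ (C₄₈ + 15)·𝓛⁻¹⁰⁰·Σ_{idx} Re 𝔠*·|Q_g(ρ)H_f(ρ)|·Re ω` — at ONE modulus with every constant and
  binder visible (`crossCell_two_lowering_at`: Prop. 2.2 (i) at `D`, Lemma 4.8 at `D` with its constant `C₄₈`, the weight
  positivity `Re 𝔠*·Re ω ≥ 0` on `idx χ`), then for all large `D` displayed GIVEN the weight positivity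
  (`crossCell_two_lowering_of_weights`, `C = C₄₈ + 15`), and with that binder ELIMINATED for every large `c′` by
  `KnifeEdge.weights_nonneg_eventually` (`crossCell_two_lowering`); `|τ(χ)⁻¹| = D^{−1/2}` (`norm_inv_tau_eq`). The
  remainder is the «R₁» leg, closed by Cauchy–Schwarz + K0 in the display; the main term
  is Lemma 8.1's left side on the data `a₁ = D·δ_D ⋆ (υ1_{≤D⁴} ⋆ χg ⋆ χf)`, `a₂ = ν1_{≤D⁴}` up to the factor
  `−χ(p)/τ(χ)` (`|τ(χ)| = √D`) — the repackaging of `ψ(D)D^{1−ρ}G·Q_g·H_f` as ONE `Skeleton.Apoly` and the re-run of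
  Lemma 8.1 / Prop. 7.1 for that D-shifted divisor-bounded data are NOT done here (D-audit §4: XL; the tree's
  `Skeleton.Lemma81`/`Prop71` bind `Adm72` data with a fixed bound; and the repackaging is valid only for
  `D ≥ D₀(θ_f + θ_g)` — support `D⁵P^{θ_f+θ_g} < PT⁻²` — a PER-PAIR threshold that escapes as `θ_f + θ_g → 1⁻`, the (7.2)
  boundary).

Typer: ls-knife-toeplitz-typer-1 g2 (literature-prover), file-disjoint from ls-knife-K0-p1's K0 files and ls-knife-typer-3's
DarkSchur file.

## References
* Y. Zhang, arXiv:2211.02515v1 (2022), §2 (2.2), (2.4)–(2.5) p. 4, (2.14)–(2.16); §4 Lemma 4.8 p. 9–10; §8 (8.5) Lemma 8.1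
  p. 16; §15 p. 80 (the unit `Z(s,ψ)/Z(s,χψ) = τ(χ)χ(p)ψ̄(D)D^{s−1}(1+O(e^{−πt}))`).
  [cite: Zhang2022LandauSiegel, §15 p.80; §4 Lemma 4.8 p.9; §8 (8.5) p.16]
-/

noncomputable section

open Complex Real ComplexConjugate Finset

namespace Literature.NumberTheory.LFunctions.Zhang2022.KnifeEdge

open Repair Skeleton

/-! ### Part 1 — the (M4) unit `τ(χ)χ(p)ψ̄(D)D^{s−1}` and `Z(s,ψ)/Z(s,χψ)` on any line `Im s ≥ 1` -/

section M4

variable {D : ℕ} [NeZero D] (χ : DirichletCharacter ℂ D) (x : Chr D)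

/-- **The (M4) unit `𝔲(s,ψ) = τ(χ)χ(p)ψ̄(D)D^{s−1}`** — the main term of `Z(s,ψ)/Z(s,χψ)` (§15 p. 80; `|𝔲| = 1` on the
critical line since `|τ(χ)| = √D`). [cite: Zhang2022LandauSiegel, §15 p.80, §2 (2.4)–(2.5)] -/
def m4Unit (s : ℂ) : ℂ :=
  GammaFactor.tau χ * χ (x.p : ZMod D) * conj (x.ψ (D : ZMod x.p)) * (D : ℂ) ^ (s - 1)

variable {χ x}

omit [NeZero D] in
/-- `p` and `D` are coprime for a member of Zhang's family once `D ≥ 3` (`p > D`). [cite: Zhang2022LandauSiegel, §2 p.4] -/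
theorem coprime_p_of_three_le (hD : 3 ≤ D) (x : Chr D) : Nat.Coprime x.p D := by
  have hDp : D < x.p := Typed.Sec14.lt_of_mem_primeWindow hD x.mem
  exact (Nat.Prime.coprime_iff_not_dvd x.prime).mpr fun h => by
    have := Nat.le_of_dvd (by omega) h; omega

/-- **The exact inverse of the (M4) unit:** `𝔲(s,ψ)·(χ(−1)τ(χ)ψ(D)χ(p)D^{−s}) = 1` — from `τ(χ)² = χ(−1)D` (real primitive
`χ`), `χ(p)² = 1`, `ψ̄(D)ψ(D) = 1` (`p ∤ D`). (The block `hMinv` of the tree's `step15_u006_holds`.)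
[cite: Zhang2022LandauSiegel, §15 p.80, §2 (2.5)] -/
theorem m4Unit_mul_inv_eq_one (hD : 3 ≤ D) (hq : χ.IsQuadratic) (hχ : χ.IsPrimitive) (x : Chr D) (s : ℂ) :
    m4Unit χ x s * (χ (-1) * GammaFactor.tau χ * x.ψ (D : ZMod x.p) * χ (x.p : ZMod D) * (D : ℂ) ^ (-s)) = 1 := by
  have hD0 : (D : ℂ) ≠ 0 := Nat.cast_ne_zero.mpr (by omega)
  have hcopPD : Nat.Coprime x.p D := coprime_p_of_three_le hD x
  have hcop : Nat.Coprime D x.p := hcopPD.symm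
  have hττ : GammaFactor.tau χ * GammaFactor.tau χ = χ (-1) * D := by
    have h := Literature.NumberTheory.LFunctions.gaussSum_mul_gaussSum_inv χ hχ
    rw [MulChar.IsQuadratic.inv hq] at h
    exact h
  have hχχ : χ (-1) * χ (-1) = 1 := by
    rw [← map_mul, neg_mul_neg, one_mul, map_one]
  have hχp : χ (x.p : ZMod D) * χ (x.p : ZMod D) = 1 := by
    have hu : IsUnit (x.p : ZMod D) := (ZMod.isUnit_iff_coprime x.p D).mpr hcopPD
    have hne : χ (x.p : ZMod D) ≠ 0 := (hu.map χ).ne_zero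
    rcases hq (x.p : ZMod D) with h | h | h
    · exact absurd h hne
    · rw [h, one_mul]
    · rw [h]; norm_num
  have hψD : conj (x.ψ (D : ZMod x.p)) * x.ψ (D : ZMod x.p) = 1 := by
    have hu : IsUnit (D : ZMod x.p) := (ZMod.isUnit_iff_coprime D x.p).mpr hcop
    have hn : ‖x.ψ (D : ZMod x.p)‖ = 1 := by
      have := DirichletCharacter.unit_norm_eq_one x.ψ hu.unit
      rwa [IsUnit.unit_spec] at this
    have hne : x.ψ (D : ZMod x.p) ≠ 0 := by
      intro h; rw [h, norm_zero] at hn; exact zero_ne_one hn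
    rw [← Complex.inv_eq_conj hn, inv_mul_cancel₀ hne]
  have hDpow : (D : ℂ) ^ (s - 1) * (D : ℂ) ^ (-s) = (D : ℂ)⁻¹ := by
    rw [← cpow_add _ _ hD0, show s - 1 + -s = (-1 : ℂ) by ring, cpow_neg_one]
  unfold m4Unit
  calc GammaFactor.tau χ * χ (x.p : ZMod D) * conj (x.ψ (D : ZMod x.p)) * (D : ℂ) ^ (s - 1) *
        (χ (-1) * GammaFactor.tau χ * x.ψ (D : ZMod x.p) * χ (x.p : ZMod D) * (D : ℂ) ^ (-s))
      = (GammaFactor.tau χ * GammaFactor.tau χ) * (χ (x.p : ZMod D) * χ (x.p : ZMod D)) *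
          (conj (x.ψ (D : ZMod x.p)) * x.ψ (D : ZMod x.p)) * χ (-1) *
          ((D : ℂ) ^ (s - 1) * (D : ℂ) ^ (-s)) := by ring
    _ = χ (-1) * D * 1 * 1 * χ (-1) * (D : ℂ)⁻¹ := by rw [hττ, hχp, hψD, hDpow]
    _ = (χ (-1) * χ (-1)) * ((D : ℂ) * (D : ℂ)⁻¹) := by ring
    _ = 1 := by rw [hχχ, mul_inv_cancel₀ hD0, one_mul]

/-- The (M4) unit is non-zero. [cite: Zhang2022LandauSiegel, §15 p.80] -/
theorem m4Unit_ne_zero (hD : 3 ≤ D) (hq : χ.IsQuadratic) (hχ : χ.IsPrimitive) (x : Chr D) (s : ℂ) :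
    m4Unit χ x s ≠ 0 := fun h => by
  have := m4Unit_mul_inv_eq_one hD hq hχ x s
  rw [h, zero_mul] at this
  exact zero_ne_one this

/-- **`𝔲(s,ψ)⁻¹ = χ(−1)τ(χ)ψ(D)χ(p)D^{−s}`** `= (χ(p)/τ(χ))·ψ(D)·D^{1−s}` (DISPLAY #1 (2): «`u = χ(p)ψ(D)D^{1−ρ}/τ(χ)`»).
[cite: Zhang2022LandauSiegel, §15 p.80, §2 (2.5)] -/
theorem m4Unit_inv_eq (hD : 3 ≤ D) (hq : χ.IsQuadratic) (hχ : χ.IsPrimitive) (x : Chr D) (s : ℂ) :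
    (m4Unit χ x s)⁻¹ = χ (-1) * GammaFactor.tau χ * x.ψ (D : ZMod x.p) * χ (x.p : ZMod D) * (D : ℂ) ^ (-s) :=
  (eq_inv_of_mul_eq_one_right (m4Unit_mul_inv_eq_one hD hq hχ x s)).symm

/-- **(M4) ON ANY HORIZONTAL LEVEL `Im s ≥ 1`:** for `D ≥ 3`, `χ` real primitive, `ψ ∈ Ψ`:
`‖Z(s,ψ)/Z(s,χψ) − τ(χ)χ(p)ψ̄(D)D^{s−1}‖ ≤ 15e^{−π Im s}·‖τ(χ)χ(p)ψ̄(D)D^{s−1}‖`. This is the tree theorem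
`Typed.Section15A.step15_u006_holds` (§15 p. 80, `s ∈ 𝔍(−α)`) with the segment hypothesis replaced by `1 ≤ Im s`, which
is all its proof uses; the proof is that proof (exact (2.4) at `θ = ψ` and `θ = χψ`, `τ(χψ) = τ(χ)τ(ψ)ψ(D)χ(p)`,
`|r_θ| ≤ 3e^{−πt}`, `|(1+r_θ)⁻¹ − 1| ≤ 6e^{−πt}`). [cite: Zhang2022LandauSiegel, §15 p.80, §2 (2.4)–(2.5) p.4] -/
theorem norm_zfac_div_zpc_sub_m4Unit_le (hD : 3 ≤ D) (hq : χ.IsQuadratic) (hχ : χ.IsPrimitive) (x : Chr D)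
    {s : ℂ} (ht1 : 1 ≤ s.im) :
    ‖GammaFactor.Zfac x.ψ s / Zpc χ x s - m4Unit χ x s‖ ≤ 15 * Real.exp (-π * s.im) * ‖m4Unit χ x s‖ := by
  set M : ℂ := m4Unit χ x s with hMdef
  -- sizes of `t`, `D`, `p`
  have hspos : 0 < s.im := by linarith
  have hD0 : (D : ℂ) ≠ 0 := Nat.cast_ne_zero.mpr (by omega)
  have hp0 : (x.p : ℂ) ≠ 0 := Nat.cast_ne_zero.mpr x.prime.ne_zero
  have hcopPD : Nat.Coprime x.p D := coprime_p_of_three_le hD x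
  have hcop : Nat.Coprime D x.p := hcopPD.symm
  -- the exact (2.4) for `ψ` and for `χψ`
  have hZψ := GammaFactor.Zfac_eq x.ψ hspos
  have hZθ : Zpc χ x s = (psiChi χ x) (-1) * GammaFactor.tau (psiChi χ x) *
      ((D * x.p : ℕ) : ℂ) ^ (-s) * GammaFactor.vartheta s * (1 + GammaFactor.corr (psiChi χ x) s) :=
    GammaFactor.Zfac_eq (psiChi χ x) hspos
  have hsign : (psiChi χ x) (-1) = χ (-1) * x.ψ (-1) := Section4.psiChi_neg_one χ x
  have hτ : GammaFactor.tau (psiChi χ x) =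
      GammaFactor.tau χ * GammaFactor.tau x.ψ * x.ψ (D : ZMod x.p) * χ (x.p : ZMod D) :=
    Typed.Section15A.step15_u005_holds D χ x hcop
  -- `(Dp)^{−s} = D^{−s} p^{−s}`
  have hpow : ((D * x.p : ℕ) : ℂ) ^ (-s) = (D : ℂ) ^ (-s) * (x.p : ℂ) ^ (-s) := by
    have e1 : ((x.p : ℕ) : ℂ) = ((x.p : ℝ) : ℂ) := (Complex.ofReal_natCast x.p).symm
    have e0 : ((D : ℕ) : ℂ) = ((D : ℝ) : ℂ) := (Complex.ofReal_natCast D).symm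
    have e2 : ((D * x.p : ℕ) : ℂ) = ((D : ℝ) : ℂ) * ((x.p : ℝ) : ℂ) := by push_cast; ring
    rw [e2, e0, e1, Complex.mul_cpow_ofReal_nonneg (Nat.cast_nonneg D) (Nat.cast_nonneg x.p)]
  -- non-vanishing of the factors of `Z(s,χψ)`
  set r₁ : ℂ := GammaFactor.corr x.ψ s with hr₁
  set r₂ : ℂ := GammaFactor.corr (psiChi χ x) s with hr₂
  have hr₂ne : 1 + r₂ ≠ 0 := GammaFactor.one_add_corr_ne_zero (psiChi χ x) hspos
  have hχχ : χ (-1) * χ (-1) = 1 := by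
    rw [← map_mul, neg_mul_neg, one_mul, map_one]
  -- `M · (χ(−1)τ(χ)ψ(D)χ(p)D^{−s}) = 1`
  have hMinv : M * (χ (-1) * GammaFactor.tau χ * x.ψ (D : ZMod x.p) * χ (x.p : ZMod D) *
      (D : ℂ) ^ (-s)) = 1 := m4Unit_mul_inv_eq_one hD hq hχ x s
  -- `Z(s,χψ) ≠ 0`
  have hZθne : Zpc χ x s ≠ 0 := by
    rw [Zpc]
    exact GammaFactor.Zfac_ne_zero (psiChiPrimitive_holds D χ x hD hχ) hspos
  -- the exact ratio: `Z(s,ψ)/Z(s,χψ) = M · (1 + r_ψ)(1 + r_{χψ})⁻¹`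
  have hratio : GammaFactor.Zfac x.ψ s / Zpc χ x s = M * ((1 + r₁) * (1 + r₂)⁻¹) := by
    rw [div_eq_iff hZθne, hZθ, hsign, hτ, hpow, hZψ]
    symm
    calc M * ((1 + r₁) * (1 + r₂)⁻¹) *
          (χ (-1) * x.ψ (-1) *
            (GammaFactor.tau χ * GammaFactor.tau x.ψ * x.ψ (D : ZMod x.p) * χ (x.p : ZMod D)) *
            ((D : ℂ) ^ (-s) * (x.p : ℂ) ^ (-s)) * GammaFactor.vartheta s * (1 + r₂))
        = (M * (χ (-1) * GammaFactor.tau χ * x.ψ (D : ZMod x.p) * χ (x.p : ZMod D) *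
            (D : ℂ) ^ (-s))) * ((1 + r₂)⁻¹ * (1 + r₂)) *
            (x.ψ (-1) * GammaFactor.tau x.ψ * (x.p : ℂ) ^ (-s) * GammaFactor.vartheta s *
              (1 + r₁)) := by ring
      _ = x.ψ (-1) * GammaFactor.tau x.ψ * (x.p : ℂ) ^ (-s) * GammaFactor.vartheta s *
            (1 + r₁) := by rw [hMinv, inv_mul_cancel₀ hr₂ne, one_mul, one_mul]
  -- the `O(e^{−πt})`: `|(1 + r₁)(1 + r₂)⁻¹ − 1| ≤ 15e^{−πt}`
  have h1 : ‖r₁‖ ≤ 3 * Real.exp (-π * s.im) := GammaFactor.norm_corr_le x.ψ ht1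
  have h2 : ‖(1 + r₂)⁻¹ - 1‖ ≤ 6 * Real.exp (-π * s.im) :=
    GammaFactor.norm_inv_one_add_corr_sub_one_le (psiChi χ x) ht1
  have he3 : Real.exp (-π * s.im) ≤ 1 / 3 := GammaFactor.exp_neg_pi_mul_le ht1
  have he0 : 0 ≤ Real.exp (-π * s.im) := (Real.exp_pos _).le
  have hcorr : ‖(1 + r₁) * (1 + r₂)⁻¹ - 1‖ ≤ 15 * Real.exp (-π * s.im) := by
    have hexpand : (1 + r₁) * (1 + r₂)⁻¹ - 1 = r₁ * ((1 + r₂)⁻¹ - 1) + r₁ + ((1 + r₂)⁻¹ - 1) := by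
      ring
    rw [hexpand]
    calc ‖r₁ * ((1 + r₂)⁻¹ - 1) + r₁ + ((1 + r₂)⁻¹ - 1)‖
        ≤ ‖r₁‖ * ‖(1 + r₂)⁻¹ - 1‖ + ‖r₁‖ + ‖(1 + r₂)⁻¹ - 1‖ := by
          calc ‖r₁ * ((1 + r₂)⁻¹ - 1) + r₁ + ((1 + r₂)⁻¹ - 1)‖
              ≤ ‖r₁ * ((1 + r₂)⁻¹ - 1) + r₁‖ + ‖(1 + r₂)⁻¹ - 1‖ := norm_add_le _ _
            _ ≤ ‖r₁ * ((1 + r₂)⁻¹ - 1)‖ + ‖r₁‖ + ‖(1 + r₂)⁻¹ - 1‖ := by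
                gcongr; exact norm_add_le _ _
            _ ≤ ‖r₁‖ * ‖(1 + r₂)⁻¹ - 1‖ + ‖r₁‖ + ‖(1 + r₂)⁻¹ - 1‖ := by
                gcongr; exact norm_mul_le _ _
      _ ≤ 3 * Real.exp (-π * s.im) * (6 * Real.exp (-π * s.im)) + 3 * Real.exp (-π * s.im) +
            6 * Real.exp (-π * s.im) := by
          gcongr
      _ ≤ 15 * Real.exp (-π * s.im) := by nlinarith
  rw [hratio, show M * ((1 + r₁) * (1 + r₂)⁻¹) - M = M * ((1 + r₁) * (1 + r₂)⁻¹ - 1) by ring,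
    norm_mul]
  calc ‖M‖ * ‖(1 + r₁) * (1 + r₂)⁻¹ - 1‖ ≤ ‖M‖ * (15 * Real.exp (-π * s.im)) :=
        mul_le_mul_of_nonneg_left hcorr (norm_nonneg _)
    _ = 15 * Real.exp (-π * s.im) * ‖M‖ := by ring

/-- **`|𝔲(s,ψ)| = 1` on the critical line** (`|τ(χ)| = √D`, `|χ(p)| = |ψ(D)| = 1`, `|D^{s−1}| = D^{−1/2}`).
[cite: Zhang2022LandauSiegel, §15 p.80, §2 (2.5)] -/
theorem norm_m4Unit_eq_one (hD : 3 ≤ D) (hχ : χ.IsPrimitive) (x : Chr D) {s : ℂ}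
    (hre : s.re = 1 / 2) : ‖m4Unit χ x s‖ = 1 := by
  have hD0 : (0 : ℝ) < D := by exact_mod_cast (show 0 < D by omega)
  have hcopPD : Nat.Coprime x.p D := coprime_p_of_three_le hD x
  have hcop : Nat.Coprime D x.p := hcopPD.symm
  have hτ : ‖GammaFactor.tau χ‖ = Real.sqrt D := GammaFactor.norm_tau hχ
  have hχp : ‖χ (x.p : ZMod D)‖ = 1 := by
    have hu : IsUnit (x.p : ZMod D) := (ZMod.isUnit_iff_coprime x.p D).mpr hcopPD
    have := DirichletCharacter.unit_norm_eq_one χ hu.unit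
    rwa [IsUnit.unit_spec] at this
  have hψD : ‖conj (x.ψ (D : ZMod x.p))‖ = 1 := by
    rw [Complex.norm_conj]
    have hu : IsUnit (D : ZMod x.p) := (ZMod.isUnit_iff_coprime D x.p).mpr hcop
    have := DirichletCharacter.unit_norm_eq_one x.ψ hu.unit
    rwa [IsUnit.unit_spec] at this
  have hpow : ‖(D : ℂ) ^ (s - 1)‖ = (D : ℝ) ^ (-(1 / 2 : ℝ)) := by
    rw [Complex.norm_natCast_cpow_of_pos (by omega)]
    congr 1
    simp [hre]
    norm_num
  rw [m4Unit, norm_mul, norm_mul, norm_mul, hτ, hχp, hψD, hpow, mul_one, mul_one,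
    Real.sqrt_eq_rpow, ← Real.rpow_add hD0]
  norm_num

end M4

/-! ### Part 2 — Lemma 4.8 and the height of the zeros on the index set `idx χ` -/

section OnIdx

variable {D : ℕ} [NeZero D] {χ : DirichletCharacter ℂ D}

omit [NeZero D] in
/-- **The zeros of `𝔷(ψ)` sit at height `Im ρ ≥ 5𝓛⁵¹⁹`** (`|Im ρ − 2πt₀| < 𝓛₁ = 𝓛⁴⁰⁵ ≤ 𝓛⁵¹⁹ = t₀`, `𝓛 ≥ 1`).
[cite: Zhang2022LandauSiegel, §2 (2.8), (2.14)] -/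
theorem five_pow_le_im_of_mem_zeroSet (hL : 1 ≤ ell D) {x : Chr D} {ρ : ℂ} (hρ : ρ ∈ zeroSet D x) :
    5 * ell D ^ 519 ≤ ρ.im := by
  obtain ⟨-, him, -⟩ := hρ
  have ht0 : t0 D = ell D ^ 519 := rfl
  have hell1 : ell1 D = ell D ^ 405 := rfl
  have h405 : ell D ^ 405 ≤ ell D ^ 519 := pow_le_pow_right₀ hL (by norm_num)
  have h519 : (0 : ℝ) ≤ ell D ^ 519 := by positivity
  have hπ : 3 * ell D ^ 519 ≤ π * ell D ^ 519 := mul_le_mul_of_nonneg_right Real.pi_gt_three.le h519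
  have h1 := (abs_lt.mp him).1
  rw [hell1, ht0] at h1
  linarith

/-- `e^{−x} ≤ 1/x` for `x > 0`. [folklore] -/
private theorem exp_neg_le_inv {y : ℝ} (hy : 0 < y) : Real.exp (-y) ≤ y⁻¹ := by
  rw [Real.exp_neg, inv_le_inv₀ (Real.exp_pos _) hy]
  linarith [Real.add_one_le_exp y]

omit [NeZero D] in
/-- **On `𝔷(ψ)`, `e^{−π Im ρ} ≤ 𝓛⁻¹⁰⁰`** (indeed `≤ e^{−5𝓛⁵¹⁹}`; `𝓛 ≥ 1`). [cite: Zhang2022LandauSiegel, §2 (2.8), (2.14)] -/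
theorem exp_neg_pi_im_le_of_mem_zeroSet (hL : 1 ≤ ell D) {x : Chr D} {ρ : ℂ} (hρ : ρ ∈ zeroSet D x) :
    Real.exp (-π * ρ.im) ≤ (ell D ^ 100)⁻¹ := by
  have h5 := five_pow_le_im_of_mem_zeroSet hL hρ
  have h519 : (1 : ℝ) ≤ ell D ^ 519 := one_le_pow₀ hL
  have h100 : (0 : ℝ) < ell D ^ 100 := by positivity
  have hρpos : 0 < ρ.im := by linarith
  -- `e^{−π Im ρ} ≤ e^{−Im ρ} ≤ 1/Im ρ ≤ 1/(5𝓛⁵¹⁹) ≤ 𝓛⁻¹⁰⁰`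
  have hle : Real.exp (-π * ρ.im) ≤ Real.exp (-ρ.im) :=
    Real.exp_le_exp.mpr (by nlinarith [Real.pi_gt_three])
  refine hle.trans ((exp_neg_le_inv hρpos).trans ?_)
  rw [inv_le_inv₀ hρpos h100]
  have hpow : ell D ^ 100 ≤ ell D ^ 519 := pow_le_pow_right₀ hL (by norm_num)
  linarith

/-- **LEMMA 4.8 ON THE INDEX SET:** for all large `D`, at every `(ψ,ρ) ∈ idx χ`,
`‖Z̃(ρ,ψ)⁻¹ + G(ρ,ψ)F(1−ρ,ψ̄)‖ ≤ C𝓛⁻¹⁰⁰` — the tree's Lemma 4.8 (`Skeleton.lemma48_holds`, unconditional) read at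
`ψ ∈ Ψ₁`, `ρ ∈ 𝔷(ψ) ⊆ {zeros of L(s,ψ)L(s,ψχ) in Ω}` (`Skeleton.mem_prodZeroSetOmega_of_mem_zeroSet`).
[cite: Zhang2022LandauSiegel, §4 Lemma 4.8 p.9–10, §2 (2.14)] -/
theorem lemma48_on_idx : ∃ C : ℝ, ForAllLarge fun D _ χ => ∀ i ∈ idx χ,
    ‖(tildeZW χ i.1 i.2)⁻¹ + Gpoly χ i.1 i.2 * FpolyBar χ i.1 (1 - i.2)‖ ≤ C * (ell D ^ 100)⁻¹ := by
  obtain ⟨C, hC⟩ := lemma48_holds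
  refine ⟨C, hC.mono fun D _ χ _ _ h i hi => ?_⟩
  obtain ⟨h1, h2⟩ := Section11Deductions.mem_idx χ hi
  exact h i.1 h1 i.2 (mem_prodZeroSetOmega_of_mem_zeroSet χ h2)

end OnIdx

/-! ### Part 3 — the pointwise lowering `Z(ρ,ψ)⁻² = −𝔲(ρ,ψ)⁻¹·G(ρ,ψ)F(1−ρ,ψ̄) + O(𝓛⁻¹⁰⁰)` -/

section Pointwise

variable {D : ℕ} [NeZero D] {χ : DirichletCharacter ℂ D}

omit [NeZero D] in
/-- `1 ≤ 𝓛` once `D ≥ 3`. [folklore] -/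
private theorem one_le_ell_of_three_le' (hD : 3 ≤ D) : 1 ≤ ell D := by
  have hD' : (3 : ℝ) ≤ D := by exact_mod_cast hD
  have h : (1 : ℝ) < Real.log 3 := by
    rw [Real.lt_log_iff_exp_lt (by norm_num)]
    exact Real.exp_one_lt_d9.trans (by norm_num)
  exact le_trans h.le (Real.log_le_log (by norm_num) hD')

/-- **`𝔲(s,ψ)⁻¹ = τ(χ)⁻¹·χ(p)ψ(D)D^{1−s}`** (the form with the prefactor `1/τ(χ)`, `|τ(χ)| = √D`, that DISPLAY #3 §1 keeps in
front of `𝔖`: `χ(−1)τ(χ) = D/τ(χ)`). [cite: Zhang2022LandauSiegel, §15 p.80, §2 (2.5)] -/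
theorem m4Unit_inv_eq' (hD : 3 ≤ D) (hq : χ.IsQuadratic) (hχ : χ.IsPrimitive) (x : Chr D) (s : ℂ) :
    (m4Unit χ x s)⁻¹ =
      (GammaFactor.tau χ)⁻¹ * (χ (x.p : ZMod D) * x.ψ (D : ZMod x.p) * (D : ℂ) ^ (1 - s)) := by
  have hD0 : (D : ℂ) ≠ 0 := Nat.cast_ne_zero.mpr (by omega)
  have hτ0 : GammaFactor.tau χ ≠ 0 := GammaFactor.tau_ne_zero hχ
  have hττ : GammaFactor.tau χ * GammaFactor.tau χ = χ (-1) * D := by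
    have h := Literature.NumberTheory.LFunctions.gaussSum_mul_gaussSum_inv χ hχ
    rw [MulChar.IsQuadratic.inv hq] at h
    exact h
  have hχχ : χ (-1) * χ (-1) = 1 := by
    rw [← map_mul, neg_mul_neg, one_mul, map_one]
  -- `χ(−1)τ(χ) = D·τ(χ)⁻¹`
  have hkey : χ (-1) * GammaFactor.tau χ = (D : ℂ) * (GammaFactor.tau χ)⁻¹ := by
    rw [eq_mul_inv_iff_mul_eq₀ hτ0]
    calc χ (-1) * GammaFactor.tau χ * GammaFactor.tau χ = χ (-1) * (χ (-1) * D) := by rw [mul_assoc, hττ]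
      _ = (χ (-1) * χ (-1)) * D := by ring
      _ = D := by rw [hχχ, one_mul]
  have hpow : (D : ℂ) ^ (1 - s) = (D : ℂ) * (D : ℂ) ^ (-s) := by
    rw [show (1 : ℂ) - s = 1 + -s by ring, cpow_add _ _ hD0, cpow_one]
  rw [m4Unit_inv_eq hD hq hχ x s, hpow]
  calc χ (-1) * GammaFactor.tau χ * x.ψ (D : ZMod x.p) * χ (x.p : ZMod D) * (D : ℂ) ^ (-s)
      = (χ (-1) * GammaFactor.tau χ) * (χ (x.p : ZMod D) * x.ψ (D : ZMod x.p) * (D : ℂ) ^ (-s)) := by ring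
    _ = (D : ℂ) * (GammaFactor.tau χ)⁻¹ * (χ (x.p : ZMod D) * x.ψ (D : ZMod x.p) * (D : ℂ) ^ (-s)) := by rw [hkey]
    _ = (GammaFactor.tau χ)⁻¹ * (χ (x.p : ZMod D) * x.ψ (D : ZMod x.p) * ((D : ℂ) * (D : ℂ) ^ (-s))) := by ring

/-- `Z̃(s,ψ) = Z(s,ψ)·Z(s,ψχ)` in the tree's names (`Skeleton.tildeZW`, `GammaFactor.tildeZ`, `Skeleton.Zpc`).
[cite: Zhang2022LandauSiegel, §4 (4.4) p.8] -/
theorem tildeZW_eq_zfac_mul_zpc (x : Chr D) (s : ℂ) :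
    tildeZW χ x s = GammaFactor.Zfac x.ψ s * Zpc χ x s := rfl

/-- **THE POINTWISE LOWERING** (DISPLAY #1 (2)–(5), DISPLAY #3 §1 (1a)): on the critical line (`Re ρ = ½`, `Im ρ ≥ 1`),
`Z(ρ,ψ)⁻² = Z̃(ρ,ψ)⁻¹·(Z(ρ,ψ)/Z(ρ,ψχ))⁻¹` exactly (`|Z(ρ,ψ)| = |Z(ρ,ψχ)| = |𝔲(ρ,ψ)| = 1`), so Lemma 4.8's
`‖Z̃(ρ,ψ)⁻¹ + G(ρ,ψ)F(1−ρ,ψ̄)‖ ≤ E` and (M4) give `‖Z(ρ,ψ)⁻² + 𝔲(ρ,ψ)⁻¹·G(ρ,ψ)F(1−ρ,ψ̄)‖ ≤ E + 15e^{−π Im ρ}`.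
[cite: Zhang2022LandauSiegel, §4 Lemma 4.8 p.9–10, §15 p.80, §2 (2.2)] -/
theorem zfac_inv_sq_lowering (hD : 3 ≤ D) (hq : χ.IsQuadratic) (hχ : χ.IsPrimitive) (x : Chr D) {ρ : ℂ}
    (hre : ρ.re = 1 / 2) (him : 1 ≤ ρ.im) {E : ℝ}
    (h48 : ‖(tildeZW χ x ρ)⁻¹ + Gpoly χ x ρ * FpolyBar χ x (1 - ρ)‖ ≤ E) :
    ‖(GammaFactor.Zfac x.ψ ρ)⁻¹ ^ 2 + (m4Unit χ x ρ)⁻¹ * (Gpoly χ x ρ * FpolyBar χ x (1 - ρ))‖ ≤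
      E + 15 * Real.exp (-π * ρ.im) := by
  have him0 : 0 < ρ.im := by linarith
  have hρ : ρ = 1 / 2 + (ρ.im : ℂ) * I := Complex.ext (by simp [hre]) (by simp)
  -- the three unimodular quantities
  have hZ1 : ‖GammaFactor.Zfac x.ψ ρ‖ = 1 := by
    rw [hρ]
    exact GammaFactor.norm_Zfac_half_eq_one x.prim him0
  have hZc1 : ‖Zpc χ x ρ‖ = 1 := norm_Zpc_eq_one (χ := χ) (psiChiPrimitive_holds D χ x hD hχ) hre him0
  have hM1 : ‖m4Unit χ x ρ‖ = 1 := norm_m4Unit_eq_one hD hχ x hre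
  have hu : ‖GammaFactor.Zfac x.ψ ρ / Zpc χ x ρ - m4Unit χ x ρ‖ ≤ 15 * Real.exp (-π * ρ.im) * ‖m4Unit χ x ρ‖ :=
    norm_zfac_div_zpc_sub_m4Unit_le hD hq hχ x him
  rw [tildeZW_eq_zfac_mul_zpc] at h48
  set Z := GammaFactor.Zfac x.ψ ρ with hZdef
  set Zc := Zpc χ x ρ with hZcdef
  set M := m4Unit χ x ρ with hMdef
  set GF := Gpoly χ x ρ * FpolyBar χ x (1 - ρ) with hGFdef
  have hZne : Z ≠ 0 := fun h => by rw [h, norm_zero] at hZ1; exact zero_ne_one hZ1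
  have hZcne : Zc ≠ 0 := fun h => by rw [h, norm_zero] at hZc1; exact zero_ne_one hZc1
  have hMne : M ≠ 0 := fun h => by rw [h, norm_zero] at hM1; exact zero_ne_one hM1
  -- (M4) inverted: `‖(Z/Zc)⁻¹ − M⁻¹‖ = ‖Z/Zc − M‖ ≤ 15e^{−πt}`
  have hu1 : ‖Z / Zc‖ = 1 := by rw [norm_div, hZ1, hZc1, div_one]
  have hune : Z / Zc ≠ 0 := div_ne_zero hZne hZcne
  have hinv : ‖(Z / Zc)⁻¹ - M⁻¹‖ ≤ 15 * Real.exp (-π * ρ.im) := by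
    have hid : (Z / Zc)⁻¹ - M⁻¹ = (M - Z / Zc) / (Z / Zc * M) := by
      field_simp
    rw [hid, norm_div, norm_mul, hu1, hM1, one_mul, div_one, norm_sub_rev]
    simpa [hM1] using hu
  -- `|Z̃⁻¹| = 1`
  have hT1 : ‖(Z * Zc)⁻¹‖ = 1 := by rw [norm_inv, norm_mul, hZ1, hZc1, mul_one, inv_one]
  -- algebra: `Z⁻² + M⁻¹GF = Z̃⁻¹((Z/Zc)⁻¹ − M⁻¹) + M⁻¹(Z̃⁻¹ + GF)`
  have halg : Z⁻¹ ^ 2 + M⁻¹ * GF = (Z * Zc)⁻¹ * ((Z / Zc)⁻¹ - M⁻¹) + M⁻¹ * ((Z * Zc)⁻¹ + GF) := by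
    field_simp
    ring
  rw [halg]
  calc ‖(Z * Zc)⁻¹ * ((Z / Zc)⁻¹ - M⁻¹) + M⁻¹ * ((Z * Zc)⁻¹ + GF)‖
      ≤ ‖(Z * Zc)⁻¹ * ((Z / Zc)⁻¹ - M⁻¹)‖ + ‖M⁻¹ * ((Z * Zc)⁻¹ + GF)‖ := norm_add_le _ _
    _ = ‖(Z / Zc)⁻¹ - M⁻¹‖ + ‖(Z * Zc)⁻¹ + GF‖ := by
        rw [norm_mul, norm_mul, hT1, norm_inv, hM1, inv_one, one_mul, one_mul]
    _ ≤ 15 * Real.exp (-π * ρ.im) + E := add_le_add hinv h48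
    _ = E + 15 * Real.exp (-π * ρ.im) := add_comm _ _

/-- **THE POINTWISE LOWERING ON THE INDEX SET, eventually:** for all large `D`, at every `(ψ,ρ) ∈ idx χ`,
`‖Z(ρ,ψ)⁻² + 𝔲(ρ,ψ)⁻¹·G(ρ,ψ)F(1−ρ,ψ̄)‖ ≤ C𝓛⁻¹⁰⁰` — Lemma 4.8 (`lemma48_on_idx`), Prop. 2.2 (i) (`prop22i_holds`:
`Re ρ = ½`), `Im ρ ≥ 5𝓛⁵¹⁹` and `e^{−π Im ρ} ≤ 𝓛⁻¹⁰⁰` on `𝔷(ψ)`. [cite: Zhang2022LandauSiegel, §4 Lemma 4.8 p.9–10, §15 p.80, §2 Prop. 2.2 (i)] -/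
theorem zfac_inv_sq_lowering_on_idx : ∃ C : ℝ, ForAllLarge fun D _ χ => ∀ i ∈ idx χ,
    ‖(GammaFactor.Zfac i.1.ψ i.2)⁻¹ ^ 2 + (m4Unit χ i.1 i.2)⁻¹ * (Gpoly χ i.1 i.2 * FpolyBar χ i.1 (1 - i.2))‖ ≤
      C * (ell D ^ 100)⁻¹ := by
  obtain ⟨C, hC⟩ := lemma48_on_idx
  refine ⟨C + 15, ((hC.and prop22i_holds).and (ForAllLarge.of_le 3 fun D _ _ hD _ _ => hD)).mono
    fun D _ χ hq hχ hh i hi => ?_⟩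
  obtain ⟨⟨h48, h22⟩, hD⟩ := hh
  obtain ⟨h1, h2⟩ := Section11Deductions.mem_idx χ hi
  have hre : i.2.re = 1 / 2 := h22 i.1 h1 i.2 (mem_prodZeroSetOmega_of_mem_zeroSet χ h2)
  have hL : 1 ≤ ell D := one_le_ell_of_three_le' hD
  have h519 : (1 : ℝ) ≤ ell D ^ 519 := one_le_pow₀ hL
  have him : 1 ≤ i.2.im := le_trans (by linarith) (five_pow_le_im_of_mem_zeroSet hL h2)
  have hexp := exp_neg_pi_im_le_of_mem_zeroSet hL h2
  calc ‖(GammaFactor.Zfac i.1.ψ i.2)⁻¹ ^ 2 + (m4Unit χ i.1 i.2)⁻¹ * (Gpoly χ i.1 i.2 * FpolyBar χ i.1 (1 - i.2))‖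
      ≤ C * (ell D ^ 100)⁻¹ + 15 * Real.exp (-π * i.2.im) :=
        zfac_inv_sq_lowering hD hq hχ i.1 hre him (h48 i hi)
    _ ≤ C * (ell D ^ 100)⁻¹ + 15 * (ell D ^ 100)⁻¹ := by gcongr
    _ = (C + 15) * (ell D ^ 100)⁻¹ := by ring

end Pointwise

/-! ### Part 4 — the summed form: `conj τ₂ = −τ(χ)⁻¹·𝔖 + R₁`, `|R₁| ≤ C𝓛⁻¹⁰⁰·Σ Re 𝔠*·|Q_gH_f|·Re ω` -/

section Summed

variable (c' : ℝ) {D : ℕ} [NeZero D] (χ : DirichletCharacter ℂ D)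

/-- **The lowered sum `𝔖 = Σ_{(ψ,ρ)∈idx} χ(p)·Re 𝔠*(ρ,ψ)·[ψ(D)D^{1−ρ}G(ρ,ψ)Q_g(ρ)H_f(ρ)]·F(1−ρ,ψ̄)·Re ω(ρ)`** (DISPLAY #3
§1 (1a); `Q_u = profPoly χ · u (⌊P⌋+1)`): Lemma 8.1's summand `𝔠*A(a₁;ρ,ψ)A(a₂;1−ρ,ψ̄)ω` for the data
`A(a₁;s,ψ) = ψ(D)D^{1−s}G(s,ψ)Q_g(s)H_f(s)` (`a₁ = D·δ_D ⋆ (υ1_{≤D⁴} ⋆ χg ⋆ χf)`) and `A(a₂;1−s,ψ̄) = F(1−s,ψ̄)`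
(`a₂ = ν1_{≤D⁴}`), weighted by the `p`-constant `χ(p)`, with the cell's real weights `Re 𝔠*`, `Re ω`.
[cite: Zhang2022LandauSiegel, §8 Lemma 8.1 (8.5) p.16, §4 Lemma 4.8 p.9, §15 p.80] -/
def tauTwoLoweredSum (g f : ℝ → ℂ) : ℂ :=
  ∑ i ∈ idx χ, χ (i.1.p : ZMod D) * ((cstar c' D i.1 i.2).re : ℂ) *
    (i.1.ψ (D : ZMod i.1.p) * (D : ℂ) ^ (1 - i.2) * Gpoly χ i.1 i.2 *
      (profPoly χ i.1 g (⌊bigP D⌋₊ + 1) i.2 * profPoly χ i.1 f (⌊bigP D⌋₊ + 1) i.2)) *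
    FpolyBar χ i.1 (1 - i.2) * ((omegaW D i.2).re : ℂ)

variable {c' χ}

omit [NeZero D] in
/-- **`conj τ₂ = Σ Re 𝔠*·Z(ρ,ψ)⁻²·Q_g(ρ)H_f(ρ)·Re ω`** when `|Z(ρ,ψ)| = 1` on the index set (DISPLAY #1 (D1): the weights
are real, `conj Z = Z⁻¹`). [cite: Zhang2022LandauSiegel, §2 (2.2), (2.16), §8 (8.5) p.16] -/
theorem conj_crossCell_two_eq (hZ : ∀ i ∈ idx χ, ‖GammaFactor.Zfac i.1.ψ i.2‖ = 1) (g f : ℝ → ℂ) :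
    conj (crossCell c' χ 2 g f) = ∑ i ∈ idx χ, ((cstar c' D i.1 i.2).re : ℂ) *
      (GammaFactor.Zfac i.1.ψ i.2)⁻¹ ^ 2 *
      (profPoly χ i.1 g (⌊bigP D⌋₊ + 1) i.2 * profPoly χ i.1 f (⌊bigP D⌋₊ + 1) i.2) *
      ((omegaW D i.2).re : ℂ) := by
  unfold crossCell zDegMeanPsi
  rw [map_sum]
  refine Finset.sum_congr rfl fun i hi => ?_
  have h2 : ((2 : ℕ) : ℤ) = ((2 : ℕ) : ℤ) := rfl
  rw [show ((2 : ℕ) : ℤ) = (2 : ℕ) from rfl, zpow_natCast]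
  simp only [map_mul, map_pow, Complex.conj_ofReal, Complex.conj_conj]
  rw [← Complex.inv_eq_conj (hZ i hi)]

/-- **THE SUMMED LOWERING AT ONE MODULUS, every constant and binder visible** (DISPLAY #3 §1 (1a)
«`conj τ₂ = −τ(χ)⁻¹·𝔖 + R₁`, `|R₁| ≤ C𝓛⁻¹⁰⁰·Σ_{idx}𝔠*|Q_gH_f|ω`»): at a modulus `D ≥ 3` with `χ` real primitive, GIVEN
Prop. 2.2 (i) at `D` (`Re ρ = ½` on the zeros in `Ω`), Lemma 4.8 at `D` with constant `C₄₈` on `idx χ`, and the weight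
positivity `Re 𝔠*·Re ω ≥ 0` on `idx χ`: for ALL pieces `g, f`,
`‖conj(crossCell c′ χ 2 g f) + τ(χ)⁻¹·𝔖‖ ≤ (C₄₈ + 15)·𝓛⁻¹⁰⁰·Σ_{idx} Re 𝔠*·|Q_g(ρ)H_f(ρ)|·Re ω` — termwise
`Re 𝔠*·Re ω·Q_gH_f·[Z(ρ,ψ)⁻² + 𝔲(ρ,ψ)⁻¹G(ρ,ψ)F(1−ρ,ψ̄)]` (`m4Unit_inv_eq'`), Part 3, and `e^{−π Im ρ} ≤ 𝓛⁻¹⁰⁰` on `𝔷(ψ)`.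
No smallness of the pieces, no K0, no (A) is used. [cite: Zhang2022LandauSiegel, §4 Lemma 4.8 p.9–10, §8 (8.5) Lemma 8.1 p.16, §15 p.80, §2 Prop. 2.2 (i)] -/
theorem crossCell_two_lowering_at (c' : ℝ) (hD : 3 ≤ D) (hq : χ.IsQuadratic) (hχ : χ.IsPrimitive)
    (h22 : ∀ x ∈ PsiOne χ, ∀ s ∈ prodZeroSetOmega χ x, s.re = 1 / 2) {C₄₈ : ℝ}
    (h48 : ∀ i ∈ idx χ, ‖(tildeZW χ i.1 i.2)⁻¹ + Gpoly χ i.1 i.2 * FpolyBar χ i.1 (1 - i.2)‖ ≤ C₄₈ * (ell D ^ 100)⁻¹)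
    (hw : ∀ i ∈ idx χ, 0 ≤ (cstar c' D i.1 i.2).re * (omegaW D i.2).re) (g f : ℝ → ℂ) :
    ‖conj (crossCell c' χ 2 g f) + (GammaFactor.tau χ)⁻¹ * tauTwoLoweredSum c' χ g f‖ ≤
      (C₄₈ + 15) * (ell D ^ 100)⁻¹ * ∑ i ∈ idx χ, (cstar c' D i.1 i.2).re *
        ‖profPoly χ i.1 g (⌊bigP D⌋₊ + 1) i.2 * profPoly χ i.1 f (⌊bigP D⌋₊ + 1) i.2‖ * (omegaW D i.2).re := by
  have hZ1 : ∀ i ∈ idx χ, ‖GammaFactor.Zfac i.1.ψ i.2‖ = 1 := norm_Zpsi_eq_one_of (χ := χ) hD h22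
  have hL : 1 ≤ ell D := one_le_ell_of_three_le' hD
  have h519 : (1 : ℝ) ≤ ell D ^ 519 := one_le_pow₀ hL
  -- Part 3 at every index, with the constant `C₄₈ + 15`
  have hlow : ∀ i ∈ idx χ, ‖(GammaFactor.Zfac i.1.ψ i.2)⁻¹ ^ 2 +
      (m4Unit χ i.1 i.2)⁻¹ * (Gpoly χ i.1 i.2 * FpolyBar χ i.1 (1 - i.2))‖ ≤ (C₄₈ + 15) * (ell D ^ 100)⁻¹ := by
    intro i hi
    obtain ⟨h1, h2⟩ := Section11Deductions.mem_idx χ hi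
    have hre : i.2.re = 1 / 2 := h22 i.1 h1 i.2 (mem_prodZeroSetOmega_of_mem_zeroSet χ h2)
    have him : 1 ≤ i.2.im := le_trans (by linarith) (five_pow_le_im_of_mem_zeroSet hL h2)
    have hexp := exp_neg_pi_im_le_of_mem_zeroSet hL h2
    calc ‖(GammaFactor.Zfac i.1.ψ i.2)⁻¹ ^ 2 + (m4Unit χ i.1 i.2)⁻¹ * (Gpoly χ i.1 i.2 * FpolyBar χ i.1 (1 - i.2))‖
        ≤ C₄₈ * (ell D ^ 100)⁻¹ + 15 * Real.exp (-π * i.2.im) :=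
          zfac_inv_sq_lowering hD hq hχ i.1 hre him (h48 i hi)
      _ ≤ C₄₈ * (ell D ^ 100)⁻¹ + 15 * (ell D ^ 100)⁻¹ := by gcongr
      _ = (C₄₈ + 15) * (ell D ^ 100)⁻¹ := by ring
  -- termwise identity
  have hterm : conj (crossCell c' χ 2 g f) + (GammaFactor.tau χ)⁻¹ * tauTwoLoweredSum c' χ g f =
      ∑ i ∈ idx χ, ((cstar c' D i.1 i.2).re : ℂ) * ((omegaW D i.2).re : ℂ) *
        (profPoly χ i.1 g (⌊bigP D⌋₊ + 1) i.2 * profPoly χ i.1 f (⌊bigP D⌋₊ + 1) i.2) *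
        ((GammaFactor.Zfac i.1.ψ i.2)⁻¹ ^ 2 +
          (m4Unit χ i.1 i.2)⁻¹ * (Gpoly χ i.1 i.2 * FpolyBar χ i.1 (1 - i.2))) := by
    rw [conj_crossCell_two_eq hZ1, tauTwoLoweredSum, Finset.mul_sum, ← Finset.sum_add_distrib]
    refine Finset.sum_congr rfl fun i _ => ?_
    rw [m4Unit_inv_eq' hD hq hχ i.1 i.2]
    ring
  rw [hterm]
  calc ‖∑ i ∈ idx χ, ((cstar c' D i.1 i.2).re : ℂ) * ((omegaW D i.2).re : ℂ) *
          (profPoly χ i.1 g (⌊bigP D⌋₊ + 1) i.2 * profPoly χ i.1 f (⌊bigP D⌋₊ + 1) i.2) *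
          ((GammaFactor.Zfac i.1.ψ i.2)⁻¹ ^ 2 +
            (m4Unit χ i.1 i.2)⁻¹ * (Gpoly χ i.1 i.2 * FpolyBar χ i.1 (1 - i.2)))‖
      ≤ ∑ i ∈ idx χ, ‖((cstar c' D i.1 i.2).re : ℂ) * ((omegaW D i.2).re : ℂ) *
          (profPoly χ i.1 g (⌊bigP D⌋₊ + 1) i.2 * profPoly χ i.1 f (⌊bigP D⌋₊ + 1) i.2) *
          ((GammaFactor.Zfac i.1.ψ i.2)⁻¹ ^ 2 +
            (m4Unit χ i.1 i.2)⁻¹ * (Gpoly χ i.1 i.2 * FpolyBar χ i.1 (1 - i.2)))‖ := norm_sum_le _ _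
    _ ≤ ∑ i ∈ idx χ, (cstar c' D i.1 i.2).re * (omegaW D i.2).re *
          ‖profPoly χ i.1 g (⌊bigP D⌋₊ + 1) i.2 * profPoly χ i.1 f (⌊bigP D⌋₊ + 1) i.2‖ *
          ((C₄₈ + 15) * (ell D ^ 100)⁻¹) := by
        refine Finset.sum_le_sum fun i hi => ?_
        rw [norm_mul, norm_mul, norm_mul, Complex.norm_real, Complex.norm_real, Real.norm_eq_abs,
          Real.norm_eq_abs, ← abs_mul, abs_of_nonneg (hw i hi)]
        exact mul_le_mul_of_nonneg_left (hlow i hi) (mul_nonneg (hw i hi) (norm_nonneg _))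
    _ = (C₄₈ + 15) * (ell D ^ 100)⁻¹ * ∑ i ∈ idx χ, (cstar c' D i.1 i.2).re *
          ‖profPoly χ i.1 g (⌊bigP D⌋₊ + 1) i.2 * profPoly χ i.1 f (⌊bigP D⌋₊ + 1) i.2‖ *
          (omegaW D i.2).re := by
        rw [Finset.mul_sum]
        refine Finset.sum_congr rfl fun i _ => ?_
        ring

/-- **THE SUMMED LOWERING, eventually in `D`, displayed GIVEN the weight positivity:** for every `c′`, with `C₄₈` the
constant of Lemma 4.8 (`lemma48_on_idx`) and `C = C₄₈ + 15`, for all large `D` (Prop. 2.2 (i) fed by `prop22i_holds`):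
if `Re 𝔠*(ρ,ψ)·Re ω(ρ) ≥ 0` on `idx χ` then for ALL pieces `g, f`,
`‖conj(crossCell c′ χ 2 g f) + τ(χ)⁻¹·𝔖‖ ≤ C𝓛⁻¹⁰⁰·Σ_{idx} Re 𝔠*·|Q_g(ρ)H_f(ρ)|·Re ω` (`crossCell_two_lowering_at`).
[cite: Zhang2022LandauSiegel, §4 Lemma 4.8 p.9–10, §8 (8.5) Lemma 8.1 p.16, §15 p.80] -/
theorem crossCell_two_lowering_of_weights (c' : ℝ) : ∃ C : ℝ, ForAllLarge fun D _ χ =>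
    (∀ i ∈ idx χ, 0 ≤ (cstar c' D i.1 i.2).re * (omegaW D i.2).re) →
      ∀ g f : ℝ → ℂ,
        ‖conj (crossCell c' χ 2 g f) + (GammaFactor.tau χ)⁻¹ * tauTwoLoweredSum c' χ g f‖ ≤
          C * (ell D ^ 100)⁻¹ * ∑ i ∈ idx χ, (cstar c' D i.1 i.2).re *
            ‖profPoly χ i.1 g (⌊bigP D⌋₊ + 1) i.2 * profPoly χ i.1 f (⌊bigP D⌋₊ + 1) i.2‖ * (omegaW D i.2).re := by
  obtain ⟨C₄₈, hC⟩ := lemma48_on_idx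
  refine ⟨C₄₈ + 15, ((hC.and prop22i_holds).and (ForAllLarge.of_le 3 fun D _ _ hD _ _ => hD)).mono
    fun D _ χ hq hχ hh hw g f => ?_⟩
  obtain ⟨⟨h48, h22⟩, hD⟩ := hh
  exact crossCell_two_lowering_at c' hD hq hχ h22 h48 hw g f

/-- **THE SUMMED LOWERING with the weight binder ELIMINATED** (Lemma 2.3 + Prop. 2.2 (i) read pointwise,
`KnifeEdge.weights_nonneg_eventually`): for every sufficiently large `c′` there is `C` with, for all large `D` and all
pieces `g, f`, `‖conj(crossCell c′ χ 2 g f) + τ(χ)⁻¹·𝔖‖ ≤ C𝓛⁻¹⁰⁰·Σ_{idx} Re 𝔠*·|Q_g(ρ)H_f(ρ)|·Re ω`. What is left of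
x₂|short after this: (i) the remainder's Cauchy–Schwarz + K0 closure `Σ Re 𝔠*|Q_g||H_f|Re ω ≤ (𝔅(g)𝔅(f))^{1/2}𝔞𝔓(1+o(1))`
(item stmt-Parity-20459 for the two pieces), (ii) Lemma 8.1 + Prop. 7.1 for the D-shifted data of `𝔖` and the crude bound
`|S_j| ≤ D^{o(1)}` (DISPLAY #3 D-audit §§2–4) — none of it in this file. [cite: Zhang2022LandauSiegel, §2 Lemma 2.3, Prop. 2.2 (i), §4 Lemma 4.8, §8 (8.5) Lemma 8.1 p.16, §15 p.80] -/
theorem crossCell_two_lowering : ∃ c₀ : ℝ, 0 ≤ c₀ ∧ ∀ c' : ℝ, c₀ ≤ c' → ∃ C : ℝ, ForAllLarge fun D _ χ =>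
    ∀ g f : ℝ → ℂ,
      ‖conj (crossCell c' χ 2 g f) + (GammaFactor.tau χ)⁻¹ * tauTwoLoweredSum c' χ g f‖ ≤
        C * (ell D ^ 100)⁻¹ * ∑ i ∈ idx χ, (cstar c' D i.1 i.2).re *
          ‖profPoly χ i.1 g (⌊bigP D⌋₊ + 1) i.2 * profPoly χ i.1 f (⌊bigP D⌋₊ + 1) i.2‖ * (omegaW D i.2).re := by
  obtain ⟨c₀, h0, hw⟩ := weights_nonneg_eventually
  refine ⟨c₀, h0, fun c' hc' => ?_⟩
  obtain ⟨C, hC⟩ := crossCell_two_lowering_of_weights c'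
  exact ⟨C, (hC.and (hw c' hc')).mono fun D _ χ _ _ hh => hh.1 hh.2⟩

/-- **`|τ(χ)⁻¹| = D^{−1/2}`** — the prefactor of `𝔖` that the D-power audit (DISPLAY #3 §0–§1) tracks: the natural scale of
`𝔖` is `√D·𝔞𝔓`, and nothing downstream compensates the `D^{−1/2}`. [cite: Zhang2022LandauSiegel, §2 (2.5) p.4] -/
theorem norm_inv_tau_eq (hχ : χ.IsPrimitive) : ‖(GammaFactor.tau χ)⁻¹‖ = (Real.sqrt D)⁻¹ := by
  rw [norm_inv, GammaFactor.norm_tau hχ]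

end Summed

end Literature.NumberTheory.LFunctions.Zhang2022.KnifeEdge

end
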